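import Summits.QuantumFields.YangMills.Theorems.F4SubCurvatureDoorLaplaceFourierRegistered
import Summits.QuantumFields.YangMills.Theorems.F4SubCurvatureDoorMirrorAnalyticity
import Summits.QuantumFields.YangMills.Theorems.F4SubCurvatureDoorSmearedSlices
import Mathlib
import HarnessLib

/-!
# LINE g21-A «shell separation» — rung R-S2a `LaplacianMultiplier` BY NAME (⟨stmt-QuantumFields-23125⟩)

Crux `F4SubCurvatureDoor.RationalToGeneral` ⟨stmt-QuantumFields-23125⟩, skeleton `Cruxes/RationalToGeneral/Lines/shell_separation.lean`, owner rung
file `Cruxes/RationalToGeneral/Lines/shell_separation_rungs.lean` (ns `…ShellSeparationRungs`).  This file restates R-S2a `LaplacianMultiplier`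
CHARACTER-IDENTICALLY and proves `laplacianMultiplier_holds : LaplacianMultiplier`: under forward-cone support the Laplacian of a class kernel at
`(t, z⃗)`, `t > 0` — the sum of the four second directional derivatives `D²K(x)(eᵢ, eᵢ)` — is the Laplace–Fourier integral weighted by the mass
squared `E² − |q⃗|²` (step (2), `k = 1`, of `stub_shellSeparation`).

PROOF (no four-dimensional `iteratedFDeriv` calculus).  `K` is real-analytic at `x = timeSpace t z ≠ 0` (tree
`F4SubCurvatureDoorGlobalReduction.mirrorAnalyticity`), hence `C²` there, and `D²K(x)(v,v)` is read off from the line `s ↦ K(x + s v)`: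
it is the derivative at `0` of any function that agrees near `0` with the derivative of that line (`iteratedFDeriv_two_eq_of_line`, two chain
rules).  Along `e₀` the line is `s ↦ ∫ e^{-(t+s)E} cos⟪q⃗,z⃗⟫ dμ` (`x + s e₀ = timeSpace (t+s) z`), along `e_{j+1}` it is
`s ↦ ∫ e^{-tE} cos(⟪q⃗,z⃗⟫ + s qⱼ) dμ` (`x + s e_{j+1} = timeSpace t (z⃗ + s e'ⱼ)`); both are differentiated twice under the integral sign
(the tree's `…SmearedSlices.hasDerivAt_integral_pow_mul_exp_mul` in time; dominated differentiation with the cone bound `|qⱼ| ≤ ‖q⃗‖ ≤ E` a.e. in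
space), giving `E²` resp. `−qⱼ²` as multipliers; `Σⱼ qⱼ² = ‖q⃗‖²`.

HONEST LABEL: one rung of an OPEN line; the stubs `ForwardConeSupport` / `ShellSeparation` / `ShellFiniteType`, ⟨23125⟩, ⟨23035⟩, R2d and the
Yang–Mills mass gap remain OPEN; no summit is proved by a line.
-/

noncomputable section

open MeasureTheory Filter Topology Set Metric
open scoped BigOperators

namespace Summit.QuantumFields.YangMills.Theorems.F4SubCurvatureDoorLaplacianMultiplierRegistered

open Summit.QuantumFields.YangMills.Theorems.F4SubCurvatureDoorLaplaceFourierRegistered (E4 E3 InClass timeSpace IsLF)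
open Summit.QuantumFields.YangMills.Theorems.F4SubCurvatureDoorSmearedSlices (integrable_pow_mul_exp_mul hasDerivAt_integral_pow_mul_exp_mul)

/-- R-S2a «LAPLACIAN MULTIPLIER» (M): under forward-cone support the Laplacian of a class kernel at `(t, z⃗)`, `t > 0` — written as the sum of
the four second directional derivatives `D²K(x)(eᵢ, eᵢ)` — is the Laplace–Fourier integral weighted by the mass squared `E² − |q⃗|²`.
[problem-side rung; GlimmJaffeQP1987 §6.2, folklore] -/
def LaplacianMultiplier : Prop :=
  ∀ K : E4 → ℝ, InClass K → ∀ μ : Measure (ℝ × E3), IsLF K μ → μ {p | p.1 < ‖p.2‖} = 0 →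
    ∀ (t : ℝ) (z : E3), 0 < t →
      Integrable (fun p : ℝ × E3 => (p.1 ^ 2 - ‖p.2‖ ^ 2) * Real.exp (-(t * p.1))) μ ∧
      (∑ i : Fin 4, iteratedFDeriv ℝ 2 K (timeSpace t z) (fun _ => EuclideanSpace.single i (1 : ℝ)))
        = ∫ p : ℝ × E3, (p.1 ^ 2 - ‖p.2‖ ^ 2) * Real.exp (-(t * p.1)) * Real.cos (inner ℝ p.2 z) ∂μ

/-! ## Second directional derivatives along lines -/

/-- Second directional derivative: for `f` twice continuously differentiable at `x`, `D²f(x)(v,v)` is the derivative at `0` of any function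
`φ'` that agrees near `0` with the derivative of `s ↦ f(x + s•v)` and is differentiable at `0`. -/
theorem iteratedFDeriv_two_eq_of_line {E : Type*} [NormedAddCommGroup E] [NormedSpace ℝ E] {f : E → ℝ} {x v : E}
    (hf : ContDiffAt ℝ 2 f x) {φ' : ℝ → ℝ} {d : ℝ}
    (hφ' : ∀ᶠ s in 𝓝 (0 : ℝ), HasDerivAt (fun r : ℝ => f (x + r • v)) (φ' s) s) (hφ'' : HasDerivAt φ' d 0) :
    iteratedFDeriv ℝ 2 f x (fun _ => v) = d := by
  rw [iteratedFDeriv_two_apply]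
  have h1 : ContDiffAt ℝ 1 (fderiv ℝ f) x := hf.fderiv_right (le_refl _)
  have hDf : HasFDerivAt (fderiv ℝ f) (fderiv ℝ (fderiv ℝ f) x) x := (h1.differentiableAt one_ne_zero).hasFDerivAt
  have hline : ∀ s : ℝ, HasDerivAt (fun r : ℝ => x + r • v) v s := fun s => by
    simpa using ((hasDerivAt_id s).smul_const v).const_add x
  have hh : HasDerivAt (fun s : ℝ => fderiv ℝ f (x + s • v) v) ((fderiv ℝ (fderiv ℝ f) x v) v) 0 := by
    have hcomp : HasDerivAt (fun s : ℝ => fderiv ℝ f (x + s • v)) ((fderiv ℝ (fderiv ℝ f) x) v) 0 :=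
      hDf.comp_hasDerivAt_of_eq (0 : ℝ) (hline 0) (by simp)
    exact hcomp.clm_apply (hasDerivAt_const (0 : ℝ) v) |>.congr_deriv (by simp)
  have hf_near : ∀ᶠ s in 𝓝 (0 : ℝ), DifferentiableAt ℝ f (x + s • v) := by
    have hev : ∀ᶠ y in 𝓝 x, ContDiffAt ℝ 2 f y := hf.eventually (by simp)
    have hcont : Tendsto (fun s : ℝ => x + s • v) (𝓝 0) (𝓝 x) := by
      have hc : Continuous (fun s : ℝ => x + s • v) := by fun_prop
      have := hc.tendsto 0
      rwa [zero_smul, add_zero] at this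
    filter_upwards [hcont.eventually hev] with s hs
    exact hs.differentiableAt (by simp)
  have heq : ∀ᶠ s in 𝓝 (0 : ℝ), fderiv ℝ f (x + s • v) v = φ' s := by
    filter_upwards [hφ', hf_near] with s hs hd
    have hg : HasDerivAt (fun r : ℝ => f (x + r • v)) (fderiv ℝ f (x + s • v) v) s :=
      hd.hasFDerivAt.comp_hasDerivAt_of_eq s (hline s) rfl
    exact hg.unique hs
  have hh' : HasDerivAt φ' ((fderiv ℝ (fderiv ℝ f) x v) v) 0 := hh.congr_of_eventuallyEq (heq.mono fun s hs => hs.symm)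
  exact (hh'.unique hφ'').symm ▸ rfl

/-! ## Coordinates of `timeSpace` and the frame lines -/

/-- Time coordinate of `timeSpace t z`. -/
theorem timeSpace_apply_zero (t : ℝ) (z : E3) : timeSpace t z 0 = t := by
  simp [timeSpace]

/-- Spatial coordinates of `timeSpace t z`. -/
theorem timeSpace_apply_succ (t : ℝ) (z : E3) (j : Fin 3) : timeSpace t z j.succ = z j := by
  simp [timeSpace]

/-- The time line: `timeSpace t z + s e₀ = timeSpace (t + s) z`. -/
theorem timeSpace_add_smul_zero (t s : ℝ) (z : E3) :
    timeSpace t z + s • EuclideanSpace.single (0 : Fin 4) (1 : ℝ) = timeSpace (t + s) z := by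
  ext k
  cases k using Fin.cases with
  | zero => simp [timeSpace_apply_zero]
  | succ j => simp [timeSpace_apply_succ, Fin.succ_ne_zero]

/-- The spatial lines: `timeSpace t z + s e_{j+1} = timeSpace t (z + s e'ⱼ)`. -/
theorem timeSpace_add_smul_succ (t s : ℝ) (z : E3) (j : Fin 3) :
    timeSpace t z + s • EuclideanSpace.single j.succ (1 : ℝ) = timeSpace t (z + s • EuclideanSpace.single j (1 : ℝ)) := by
  ext k
  cases k using Fin.cases with
  | zero => simp [timeSpace_apply_zero, (Fin.succ_ne_zero j).symm]
  | succ j' => simp [timeSpace_apply_succ, Fin.succ_inj]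

/-- `⟪q⃗, z⃗ + s e'ⱼ⟫ = ⟪q⃗, z⃗⟫ + s qⱼ`. -/
theorem inner_add_smul_single (q z : E3) (s : ℝ) (j : Fin 3) :
    inner ℝ q (z + s • EuclideanSpace.single j (1 : ℝ)) = inner ℝ q z + s * q j := by
  rw [inner_add_right, inner_smul_right, EuclideanSpace.inner_single_right]
  simp

/-! ## Differentiation under the integral along the spatial lines -/

/-- A.e. consequences of the support hypotheses: `0 ≤ E` and `‖q⃗‖ ≤ E`. -/
theorem ae_cone {μ : Measure (ℝ × E3)} (h0 : μ (Set.Iio 0 ×ˢ Set.univ) = 0) (hcone : μ {p | p.1 < ‖p.2‖} = 0) :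
    ∀ᵐ p ∂μ, 0 ≤ p.1 ∧ ‖p.2‖ ≤ p.1 := by
  have h1 : ∀ᵐ p ∂μ, p ∉ Set.Iio (0 : ℝ) ×ˢ (Set.univ : Set E3) := measure_eq_zero_iff_ae_notMem.1 h0
  have h2 : ∀ᵐ p ∂μ, p ∉ {p : ℝ × E3 | p.1 < ‖p.2‖} := measure_eq_zero_iff_ae_notMem.1 hcone
  filter_upwards [h1, h2] with p hp1 hp2
  simp only [Set.mem_prod, Set.mem_Iio, Set.mem_univ, and_true, not_lt] at hp1
  exact ⟨hp1, not_lt.1 hp2⟩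

/-- **Spatial parametric differentiation.**  For `w` with derivative `w'`, both bounded by `1`, a coordinate index `j` and `n : ℕ`:
`s ↦ ∫ e^{-tE} qⱼⁿ w(⟪q⃗,z⃗⟫ + s qⱼ) dμ` has derivative `∫ e^{-tE} qⱼⁿ⁺¹ w'(⟪q⃗,z⃗⟫ + s₀ qⱼ) dμ` at every `s₀` (dominated differentiation, bound
`Eⁿ⁺¹ e^{-tE}` from the cone). -/
theorem hasDerivAt_integral_spatial (μ : Measure (ℝ × E3)) (h0 : μ (Set.Iio 0 ×ˢ Set.univ) = 0)
    (hint : ∀ t : ℝ, 0 < t → Integrable (fun p : ℝ × E3 => Real.exp (-(t * p.1))) μ)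
    (hcone : μ {p | p.1 < ‖p.2‖} = 0) {t : ℝ} (ht : 0 < t) (z : E3) (j : Fin 3) (n : ℕ)
    (w w' : ℝ → ℝ) (hw : ∀ u, HasDerivAt w (w' u) u) (hwc : Continuous w) (hw'c : Continuous w')
    (hwb : ∀ u, |w u| ≤ 1) (hw'b : ∀ u, |w' u| ≤ 1) (s₀ : ℝ) :
    Integrable (fun p : ℝ × E3 => Real.exp (-(t * p.1)) * p.2 j ^ n * w (inner ℝ p.2 z + s₀ * p.2 j)) μ ∧
    HasDerivAt (fun s : ℝ => ∫ p : ℝ × E3, Real.exp (-(t * p.1)) * p.2 j ^ n * w (inner ℝ p.2 z + s * p.2 j) ∂μ)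
      (∫ p : ℝ × E3, Real.exp (-(t * p.1)) * p.2 j ^ (n + 1) * w' (inner ℝ p.2 z + s₀ * p.2 j) ∂μ) s₀ := by
  have hae := ae_cone h0 hcone
  have hcoord : ∀ p : ℝ × E3, |p.2 j| ≤ ‖p.2‖ := fun p => by
    have := PiLp.norm_apply_le p.2 j
    rwa [Real.norm_eq_abs] at this
  -- the integrand and its derivative
  set F : ℝ → ℝ × E3 → ℝ := fun s p => Real.exp (-(t * p.1)) * p.2 j ^ n * w (inner ℝ p.2 z + s * p.2 j) with hF
  set F' : ℝ → ℝ × E3 → ℝ := fun s p => Real.exp (-(t * p.1)) * p.2 j ^ (n + 1) * w' (inner ℝ p.2 z + s * p.2 j) with hF'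
  have hFm : ∀ s, AEStronglyMeasurable (F s) μ := fun s => by
    refine Measurable.aestronglyMeasurable ?_
    simp only [hF]
    fun_prop
  have hF'm : ∀ s, AEStronglyMeasurable (F' s) μ := fun s => by
    refine Measurable.aestronglyMeasurable ?_
    simp only [hF']
    fun_prop
  -- dominating functions `Eⁿ e^{-tE}` and `Eⁿ⁺¹ e^{-tE}`
  have hdom : ∀ m : ℕ, Integrable (fun p : ℝ × E3 => p.1 ^ m * Real.exp (-(t * p.1)) * (1 : ℝ)) μ := fun m =>
    integrable_pow_mul_exp_mul μ h0 hint (fun _ => (1 : ℝ)) measurable_const (C := 1) (fun _ => by simp) ht m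
  have hbound : ∀ (m : ℕ) (v : ℝ → ℝ), (∀ u, |v u| ≤ 1) → ∀ s, ∀ᵐ p ∂μ,
      ‖Real.exp (-(t * p.1)) * p.2 j ^ m * v (inner ℝ p.2 z + s * p.2 j)‖ ≤ p.1 ^ m * Real.exp (-(t * p.1)) * 1 := by
    intro m v hv s
    filter_upwards [hae] with p hp
    rw [Real.norm_eq_abs, abs_mul, abs_mul, abs_of_pos (Real.exp_pos _), abs_pow, mul_one]
    have h1 : |p.2 j| ^ m ≤ p.1 ^ m := pow_le_pow_left₀ (abs_nonneg _) ((hcoord p).trans hp.2) m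
    calc Real.exp (-(t * p.1)) * |p.2 j| ^ m * |v (inner ℝ p.2 z + s * p.2 j)|
        ≤ Real.exp (-(t * p.1)) * p.1 ^ m * 1 :=
          mul_le_mul (mul_le_mul_of_nonneg_left h1 (Real.exp_pos _).le) (hv _) (abs_nonneg _)
            (mul_nonneg (Real.exp_pos _).le (pow_nonneg hp.1 m))
      _ = p.1 ^ m * Real.exp (-(t * p.1)) := by ring
  have hFint : Integrable (F s₀) μ :=
    (hdom n).mono' (hFm s₀) (by simpa [hF] using hbound n w hwb s₀)
  refine ⟨by simpa [hF] using hFint, ?_⟩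
  have key := hasDerivAt_integral_of_dominated_loc_of_deriv_le (μ := μ) (F := F) (F' := F') (x₀ := s₀) (s := Set.univ)
    (bound := fun p : ℝ × E3 => p.1 ^ (n + 1) * Real.exp (-(t * p.1)) * 1) univ_mem
    (Eventually.of_forall hFm) hFint (hF'm s₀) ?_ (hdom (n + 1)) ?_
  · simpa [hF, hF'] using key.2
  · -- the bound on the derivative, uniformly in `s`
    filter_upwards [hae] with p hp s _
    rw [hF']; dsimp only
    rw [Real.norm_eq_abs, abs_mul, abs_mul, abs_of_pos (Real.exp_pos _), abs_pow, mul_one]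
    have h1 : |p.2 j| ^ (n + 1) ≤ p.1 ^ (n + 1) := pow_le_pow_left₀ (abs_nonneg _) ((hcoord p).trans hp.2) (n + 1)
    calc Real.exp (-(t * p.1)) * |p.2 j| ^ (n + 1) * |w' (inner ℝ p.2 z + s * p.2 j)|
        ≤ Real.exp (-(t * p.1)) * p.1 ^ (n + 1) * 1 :=
          mul_le_mul (mul_le_mul_of_nonneg_left h1 (Real.exp_pos _).le) (hw'b _) (abs_nonneg _)
            (mul_nonneg (Real.exp_pos _).le (pow_nonneg hp.1 (n + 1)))
      _ = p.1 ^ (n + 1) * Real.exp (-(t * p.1)) := by ring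
  · -- pointwise differentiability in `s`
    refine Eventually.of_forall fun p s _ => ?_
    simp only [hF, hF']
    have hlin : HasDerivAt (fun s : ℝ => inner ℝ p.2 z + s * p.2 j) (p.2 j) s := by
      simpa using (hasDerivAt_id s).mul_const (p.2 j) |>.const_add (inner ℝ p.2 z)
    have hcomp := (hw (inner ℝ p.2 z + s * p.2 j)).comp s hlin
    have h2 := hcomp.const_mul (Real.exp (-(t * p.1)) * p.2 j ^ n)
    exact h2.congr_deriv (by rw [pow_succ]; ring)

/-! ## The rung -/

/-- **RUNG R-S2a (by name): `LaplacianMultiplier`.** -/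
theorem laplacianMultiplier_holds : LaplacianMultiplier := by
  intro K hK μ hLF hcone t z ht
  obtain ⟨h0, hint, hrepr⟩ := hLF
  have hae := ae_cone h0 hcone
  -- integrability of the weighted density
  have hdom : ∀ m : ℕ, Integrable (fun p : ℝ × E3 => p.1 ^ m * Real.exp (-(t * p.1)) * (1 : ℝ)) μ := fun m =>
    integrable_pow_mul_exp_mul μ h0 hint (fun _ => (1 : ℝ)) measurable_const (C := 1) (fun _ => by simp) ht m
  have h2 : Integrable (fun p : ℝ × E3 => ‖p.2‖ ^ 2 * Real.exp (-(t * p.1))) μ := by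
    refine ((hdom 2).mono' (by fun_prop : Measurable fun p : ℝ × E3 => ‖p.2‖ ^ 2 * Real.exp (-(t * p.1))).aestronglyMeasurable ?_)
    filter_upwards [hae] with p hp
    rw [Real.norm_eq_abs, abs_mul, abs_of_pos (Real.exp_pos _), abs_pow, abs_norm, mul_one]
    exact mul_le_mul_of_nonneg_right (pow_le_pow_left₀ (norm_nonneg _) hp.2 2) (Real.exp_pos _).le
  have hInt : Integrable (fun p : ℝ × E3 => (p.1 ^ 2 - ‖p.2‖ ^ 2) * Real.exp (-(t * p.1))) μ := by
    have h1 : Integrable (fun p : ℝ × E3 => p.1 ^ 2 * Real.exp (-(t * p.1))) μ :=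
      (hdom 2).congr (Eventually.of_forall fun p => by simp only [mul_one])
    exact (h1.sub h2).congr (Eventually.of_forall fun p => by simp only [Pi.sub_apply]; ring)
  have hneg_sin : ∀ u, HasDerivAt Real.cos (-Real.sin u) u := Real.hasDerivAt_cos
  have hneg_cos : ∀ u, HasDerivAt (fun u => -Real.sin u) (-Real.cos u) u := fun u => (Real.hasDerivAt_sin u).neg
  refine ⟨hInt, ?_⟩
  -- the point and its analyticity
  set x : E4 := timeSpace t z with hx_def
  have hx0 : x 0 = t := timeSpace_apply_zero t z
  have hx : x ≠ 0 := fun h => by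
    have := congrArg (fun y : E4 => y 0) h
    rw [hx0] at this
    simp at this
    exact ht.ne' this
  have hKx : ContDiffAt ℝ 2 K x :=
    (Summit.QuantumFields.YangMills.Theorems.F4SubCurvatureDoorGlobalReduction.mirrorAnalyticity K hK.1 hK.2.1 hK.2.2.1
      hK.2.2.2.1 hK.2.2.2.2.2 x hx).contDiffAt
  -- the common spatial factor `cos⟪q⃗, z⃗⟫` is measurable and bounded
  have hcm : Measurable fun q : E3 => Real.cos (inner ℝ q z) := by fun_prop
  have hcb : ∀ q : E3, |Real.cos (inner ℝ q z)| ≤ 1 := fun q => Real.abs_cos_le_one _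
  -- TIME direction
  have htime : iteratedFDeriv ℝ 2 K x (fun _ => EuclideanSpace.single (0 : Fin 4) (1 : ℝ))
      = ∫ p : ℝ × E3, p.1 ^ 2 * Real.exp (-(t * p.1)) * Real.cos (inner ℝ p.2 z) ∂μ := by
    -- the line is `s ↦ Φ₀(t + s)` with `Φₙ(τ) = ∫ Eⁿ e^{-τE} cos`
    have hΦ : ∀ (n : ℕ) (τ : ℝ), 0 < τ → HasDerivAt (fun τ : ℝ => ∫ p : ℝ × E3, p.1 ^ n * Real.exp (-(τ * p.1)) * Real.cos (inner ℝ p.2 z) ∂μ)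
        (-∫ p : ℝ × E3, p.1 ^ (n + 1) * Real.exp (-(τ * p.1)) * Real.cos (inner ℝ p.2 z) ∂μ) τ :=
      fun n τ hτ => hasDerivAt_integral_pow_mul_exp_mul μ h0 hint _ hcm hcb n hτ
    refine iteratedFDeriv_two_eq_of_line hKx
      (φ' := fun s => -∫ p : ℝ × E3, p.1 ^ 1 * Real.exp (-((t + s) * p.1)) * Real.cos (inner ℝ p.2 z) ∂μ) ?_ ?_
    · -- first derivative along the line, for `|s| < t`
      have hev : ∀ᶠ s in 𝓝 (0 : ℝ), |s| < t := by
        have : Metric.ball (0 : ℝ) t ∈ 𝓝 (0 : ℝ) := Metric.ball_mem_nhds 0 ht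
        filter_upwards [this] with s hs
        rwa [Metric.mem_ball, dist_zero_right, Real.norm_eq_abs] at hs
      filter_upwards [hev] with s hs
      have hts : 0 < t + s := by rw [abs_lt] at hs; linarith
      -- `K(x + r e₀) = Φ₀(t + r)` near `s`
      have hloc : ∀ᶠ r in 𝓝 s, K (x + r • EuclideanSpace.single (0 : Fin 4) (1 : ℝ))
          = ∫ p : ℝ × E3, p.1 ^ 0 * Real.exp (-((t + r) * p.1)) * Real.cos (inner ℝ p.2 z) ∂μ := by
        have hev' : ∀ᶠ r in 𝓝 s, 0 < t + r := by
          have hc : Continuous fun r : ℝ => t + r := by fun_prop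
          exact (hc.tendsto s).eventually (lt_mem_nhds hts)
        filter_upwards [hev'] with r hr
        rw [hx_def, timeSpace_add_smul_zero, hrepr (t + r) z hr]
        simp
      have hd : HasDerivAt (fun r : ℝ => ∫ p : ℝ × E3, p.1 ^ 0 * Real.exp (-((t + r) * p.1)) * Real.cos (inner ℝ p.2 z) ∂μ)
          (-∫ p : ℝ × E3, p.1 ^ 1 * Real.exp (-((t + s) * p.1)) * Real.cos (inner ℝ p.2 z) ∂μ) s := by
        have h := (hΦ 0 (t + s) hts).comp s ((hasDerivAt_id s).const_add t)
        simpa [Function.comp_def] using h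
      exact hd.congr_of_eventuallyEq hloc
    · -- second derivative at `0`
      have hd : HasDerivAt (fun s : ℝ => ∫ p : ℝ × E3, p.1 ^ 1 * Real.exp (-((t + s) * p.1)) * Real.cos (inner ℝ p.2 z) ∂μ)
          (-∫ p : ℝ × E3, p.1 ^ 2 * Real.exp (-((t + 0) * p.1)) * Real.cos (inner ℝ p.2 z) ∂μ) 0 := by
        have h := (hΦ 1 (t + 0) (by simpa using ht)).comp (0 : ℝ) ((hasDerivAt_id (0 : ℝ)).const_add t)
        simpa [Function.comp_def] using h
      have h2' := hd.neg
      simp only [neg_neg, add_zero, pow_one] at h2' ⊢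
      exact h2'
  -- SPACE directions
  have hspace : ∀ j : Fin 3, iteratedFDeriv ℝ 2 K x (fun _ => EuclideanSpace.single j.succ (1 : ℝ))
      = -∫ p : ℝ × E3, Real.exp (-(t * p.1)) * p.2 j ^ 2 * Real.cos (inner ℝ p.2 z) ∂μ := by
    intro j
    have hd2 := fun s₀ => (hasDerivAt_integral_spatial μ h0 hint hcone ht z j 1 (fun u => -Real.sin u) (fun u => -Real.cos u)
      hneg_cos (Real.continuous_sin.neg) (Real.continuous_cos.neg) (fun u => by rw [abs_neg]; exact Real.abs_sin_le_one u)
      (fun u => by rw [abs_neg]; exact Real.abs_cos_le_one u) s₀).2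
    refine iteratedFDeriv_two_eq_of_line hKx
      (φ' := fun s => ∫ p : ℝ × E3, Real.exp (-(t * p.1)) * p.2 j ^ (0 + 1) * -Real.sin (inner ℝ p.2 z + s * p.2 j) ∂μ) ?_ ?_
    · refine Eventually.of_forall fun s => ?_
      have hloc : ∀ r : ℝ, K (x + r • EuclideanSpace.single j.succ (1 : ℝ))
          = ∫ p : ℝ × E3, Real.exp (-(t * p.1)) * p.2 j ^ 0 * Real.cos (inner ℝ p.2 z + r * p.2 j) ∂μ := by
        intro r
        rw [hx_def, timeSpace_add_smul_succ, hrepr t _ ht]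
        refine integral_congr_ae (Eventually.of_forall fun p => ?_)
        dsimp only
        rw [inner_add_smul_single, pow_zero, mul_one]
      have h := (hasDerivAt_integral_spatial μ h0 hint hcone ht z j 0 Real.cos (fun u => -Real.sin u) hneg_sin
        Real.continuous_cos (Real.continuous_sin.neg) (fun u => Real.abs_cos_le_one u)
        (fun u => by rw [abs_neg]; exact Real.abs_sin_le_one u) s).2
      refine h.congr_of_eventuallyEq (Eventually.of_forall fun r => hloc r)
    · have h := hd2 0
      simp only [zero_add, pow_one] at h ⊢
      have e : (∫ p : ℝ × E3, Real.exp (-(t * p.1)) * p.2 j ^ (1 + 1) * -Real.cos (inner ℝ p.2 z + 0 * p.2 j) ∂μ)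
          = -∫ p : ℝ × E3, Real.exp (-(t * p.1)) * p.2 j ^ 2 * Real.cos (inner ℝ p.2 z) ∂μ := by
        rw [← integral_neg]
        refine integral_congr_ae (Eventually.of_forall fun p => ?_)
        dsimp only
        rw [zero_mul, add_zero]
        ring
      rw [← e]
      exact h
  -- SUM
  have I1 : Integrable (fun p : ℝ × E3 => p.1 ^ 2 * Real.exp (-(t * p.1)) * Real.cos (inner ℝ p.2 z)) μ :=
    integrable_pow_mul_exp_mul μ h0 hint _ hcm hcb ht 2
  have I2 : Integrable (fun p : ℝ × E3 => ‖p.2‖ ^ 2 * Real.exp (-(t * p.1)) * Real.cos (inner ℝ p.2 z)) μ := by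
    refine h2.mono' ((by fun_prop : Measurable fun p : ℝ × E3 => ‖p.2‖ ^ 2 * Real.exp (-(t * p.1)) * Real.cos (inner ℝ p.2 z))
      |>.aestronglyMeasurable) (Eventually.of_forall fun p => ?_)
    rw [Real.norm_eq_abs, abs_mul, abs_mul, abs_of_pos (Real.exp_pos _), abs_pow, abs_norm]
    exact mul_le_of_le_one_right (by positivity) (hcb _)
  have I3 : ∀ j : Fin 3, Integrable (fun p : ℝ × E3 => Real.exp (-(t * p.1)) * p.2 j ^ 2 * Real.cos (inner ℝ p.2 z)) μ := by
    intro j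
    have h := (hasDerivAt_integral_spatial μ h0 hint hcone ht z j 2 Real.cos (fun u => -Real.sin u) hneg_sin
      Real.continuous_cos (Real.continuous_sin.neg) (fun u => Real.abs_cos_le_one u)
      (fun u => by rw [abs_neg]; exact Real.abs_sin_le_one u) 0).1
    refine h.congr (Eventually.of_forall fun p => ?_)
    simp
  have hnorm : ∀ q : E3, ‖q‖ ^ 2 = ∑ j : Fin 3, q j ^ 2 := fun q => by
    rw [EuclideanSpace.norm_eq, Real.sq_sqrt (Finset.sum_nonneg fun i _ => by positivity)]
    exact Finset.sum_congr rfl fun i _ => by rw [Real.norm_eq_abs, sq_abs]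
  have hsplit : ∫ p : ℝ × E3, ‖p.2‖ ^ 2 * Real.exp (-(t * p.1)) * Real.cos (inner ℝ p.2 z) ∂μ
      = ∑ j : Fin 3, ∫ p : ℝ × E3, Real.exp (-(t * p.1)) * p.2 j ^ 2 * Real.cos (inner ℝ p.2 z) ∂μ := by
    rw [← integral_finsetSum _ (fun j _ => I3 j)]
    refine integral_congr_ae (Eventually.of_forall fun p => ?_)
    dsimp only
    rw [hnorm p.2, Finset.sum_mul, Finset.sum_mul]
    exact Finset.sum_congr rfl fun j _ => by ring
  rw [Fin.sum_univ_succ, htime]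
  simp_rw [hspace]
  rw [Finset.sum_neg_distrib, ← hsplit, ← sub_eq_add_neg, ← integral_sub I1 I2]
  refine integral_congr_ae (Eventually.of_forall fun p => ?_)
  ring

end Summit.QuantumFields.YangMills.Theorems.F4SubCurvatureDoorLaplacianMultiplierRegistered

end
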